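import Summits.QuantumFields.YangMills.Theorems.BalabanUVNodesPortU8TwoVolume

/-!
# PORT PT-B (U8), file 3 — the TWO-VOLUME GEOMETRY of (1.21) at the record's CENTRED layer, part 2: sites and bonds of `X` versus `emb X`, ROW (R3) (index
# compatibility) and ROW (R5) (chart intertwining) of `B12FormatPlus.Response9D` AT THE NAMES, and THE FRAME «`Response9D` at the record from its two decay rows»

Cell `ym-nodeO-ideate` ∕ programme cell `ym-balaban-port`, porter seat `ymgap-nodeO-port-PTB-1` (gen 0) on item **stmt-QuantumFields-27931**
`BalabanUVNodes.PortPieceLocalityU8` (string of record ⁶ = `nodeO-cover/TYPER-Sig27931-v6-J.txt`, sha16 `3e2971674efa3b12`); PORT-PLAN-v1 rows U8-2V ∕ U8-R9;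
`--kind proof --supports stmt-QuantumFields-27931` (helper).  [I] = [Balaban1987RG1], [15] = [Balaban1985Variational].
CONSUMED BY NAME, nothing re-declared: part 1 (`BalabanUVNodesPortU8TwoVolume`: `mem_domSites_iff`, `cube_liftSiteCtr`, `cube_eq_of_liftSiteCtr`, `recordDomEmbCtr_val`,
`valMinAbs_add_one_of_ne_half`), DEF-1's names (`liftSiteCtr ∕ liftBondCtr ∕ liftCfgIdxCtr ∕ recordCoordProjCtr ∕ recordJXJ ∕ recordCXJ ∕ recordChartJ ∕ chartMatU ∕ chartMatJc ∕
domBonds ∕ recordResponse9DataFromJ ∕ recordGkJ ∕ recordE ∕ recordRNat ∕ recordDom44J ∕ recordSiteGeom`), typer-1's mould (`B12FormatPlus.Response9D`, `restrictCLM_apply`, `cutTo`).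

WHAT THIS FILE PROVES (theorems only; no `def`, no `instance`, no `notation`, no `sorry`; standard axioms; tiled range `K ≥ recordK₀ F Mc k`).
* §5 `liftSiteCtr_mem_domSites_iff` — a fine site lies in `X` iff its centred lift lies in `recordDomEmbCtr X` (`X ∉ recordWrapCtr`).
* §6 `liftSiteCtr_shift` — the centred lift commutes with `x ↦ x + e_μ` off the antipodal SITE layer (`x_μ ≠ n₀∕2`; sites of off-wrap domains are off it,
  `val_ne_half_of_mem_domSites`); `liftBondCtr_tgt`; ★ `liftBondCtr_mem_domBonds_iff` — a fine bond lies in `X` iff its centred lift lies in `emb X`.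
* §7 ★★ `rowR3_record` — ROW (R3): off the wrap class `recordJXJ` carries `recordCXJ X` into `recordCXJ (recordDomEmbCtr X)`; ★★ `rowR5_record` — ROW (R5):
  `recordCoordProjCtr (recordChartJ_{K+1} (recordDomEmbCtr X) w′) = recordChartJ_K X (restrictCLM (recordCXJ X) recordJXJ w′)` (both blocks: `chartMatU_restrict`, `chartMatJc_restrict`).
* §8 the same two rows in the shape the mould reads (`rowR3_fromJ ∕ rowR5_fromJ`, member `n` = volume `recordK₀ F Mc k + n`), and ★★ THE FRAME `response9D_fromJ_of_decayRows`:
  `B12FormatPlus.Response9D (recordResponse9DataFromJ …) (recordChartJ …) (recordRNat …) (recordDom44J … α₂) C₉ δ₀` from `0 ≤ C₉`, `0 ≤ δ₀` and its two DECAY rows (R1ᴰ) (gauge decay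
  of the cut responses — [15] Prop. 9 (190), CONTENT, displayed) and (R4ᴰ) (two-volume comparison on the centred window — CONTENT, displayed); (R0)∕(R3)∕(R5) discharged.

HONEST FRAMING.  Two of the five rows of 27931⁶'s `Response9D` conjunct are now theorems of the names; the two decay rows and the ι-row's `C²` clause are [15] Thm 1 ∕ Prop. 9
content at `UkSel` and are NOT asserted, ported or discharged here (PORT-PLAN-v1 §2∕§4); 27931⁶ OPEN; K0⁷ NOT closed; NODE O 0∕1; COUNT 8∕28 · K 1∕4 UNMOVED; finite `𝕋⁴_{L^K}` at
fixed ε — NOT continuum ∕ OS ∕ Clay; **the Yang–Mills mass gap (Clay) is NOT proved by any of this.**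
-/

noncomputable section

open scoped BigOperators Matrix.Norms.L2Operator

namespace Summit.QuantumFields.YangMills.Theorems.PortU8

open Literature.MathematicalPhysics.QuantumFieldTheory.Balaban1983to89
open Literature.MathematicalPhysics.QuantumFieldTheory.Balaban1983to89.Node00
open Literature.MathematicalPhysics.QuantumFieldTheory.Balaban1983to89.T4Continuum (T4Family)
open Literature.MathematicalPhysics.QuantumFieldTheory.Balaban1983to89.TreeLengthTorus (TPt IsTDom TFaceConnected TLinked TStepIn TAdj)
open Literature.MathematicalPhysics.QuantumFieldTheory.Balaban1983to89.B14.Eq213MaximalDomains (side)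
open Summit.QuantumFields.YangMills.Theorems.K0RecordFormatNames
open NormedSpace (exp)

variable (F : T4Family)

/-! ## §5  Sites and bonds of `X` versus sites and bonds of `emb X` -/

variable {F} in
/-- Cubes of an off-wrap domain are off the seam. [cite: Balaban1987RG1, (1.21) p.264 (bookkeeping)] -/
theorem not_onSeamCtr_of_mem {Mc k K : ℕ} {X : (recordDomSys F Mc k K).Dom} (hX : X ∉ recordWrapCtr F Mc k K)
    {c : TPt (F.P K).d (Sect2.domCount (F.P K) Mc (k + 1))} (hc : c ∈ (X.1 : Finset _)) : ¬ OnSeamCtr c := by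
  classical
  intro hseam
  exact hX (by simpa [recordWrapCtr] using ⟨c, hc, hseam⟩)

variable {F} in
/-- **A FINE SITE LIES IN `X` IFF ITS CENTRED LIFT LIES IN `emb X`** (`X ∉ recordWrapCtr`, tiled range). [cite: Balaban1987RG1, (1.21) p.264, (1.7) p.261] -/
theorem liftSiteCtr_mem_domSites_iff {Mc k K : ℕ} (hMc : McGuard F Mc) (hK : recordK₀ F Mc k ≤ K) (X : (recordDomSys F Mc k K).Dom)
    (hX : X ∉ recordWrapCtr F Mc k K) (x : Site (F.P K) 0) :
    liftSiteCtr F K 0 x ∈ Sect2.domSites (F.P (K + 1)) Mc (k + 1) (recordDomEmbCtr F Mc k K X) ↔ x ∈ Sect2.domSites (F.P K) Mc (k + 1) X := by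
  classical
  have hK' : recordK₀ F Mc k ≤ K + 1 := Nat.le_succ_of_le hK
  rw [mem_domSites_iff hMc hK' (recordDomEmbCtr F Mc k K X), mem_domSites_iff hMc hK X, recordDomEmbCtr_val hMc hK X hX, Finset.mem_image]
  constructor
  · rintro ⟨c, hc, hcx⟩
    rwa [← cube_eq_of_liftSiteCtr hMc hK x c hcx.symm] at hc
  · intro hx
    exact ⟨_, hx, (cube_liftSiteCtr hMc hK x (not_onSeamCtr_of_mem hX hx)).symm⟩


/-! ## §6  The centred lift commutes with the lattice shift off the antipodal site layer; bonds of `X` versus bonds of `emb X` -/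

/-- The fine torus side `n₀ = 2L^{m+K}` is even. [cite: Balaban1987RG1, (0.1) p.251 (bookkeeping)] -/
theorem even_sitesPerDir (K : ℕ) : Even ((F.P K).sitesPerDir 0) := by
  rw [T4Family.sitesPerDir_eq]; exact even_two_mul _

variable {F} in
/-- A coordinate value off the antipodal layer has minimal representative off the antipodal value. [folklore] -/
theorem valMinAbs_ne_half_of_val_ne_half {n : ℕ} [NeZero n] (z : ZMod n) (hz : z.val ≠ n / 2) : z.valMinAbs ≠ ((n / 2 : ℕ) : ℤ) := by
  rw [ZMod.valMinAbs_def_pos]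
  split_ifs with h
  · exact_mod_cast hz
  · have := ZMod.val_lt z
    push_cast
    omega

variable {F} in
/-- **THE CENTRED LIFT COMMUTES WITH `x ↦ x + e_μ` OFF THE ANTIPODAL SITE LAYER** (`x_μ ≠ n₀∕2`): `lift (x + e_μ) = lift x + e_μ`.
[cite: Balaban1987RG1, (1.21) p.264 (bookkeeping)] -/
theorem liftSiteCtr_shift {K : ℕ} (x : Site (F.P K) 0) (μ : Fin (F.P K).d) (hx : (x μ).val ≠ (F.P K).sitesPerDir 0 / 2) :
    liftSiteCtr F K 0 (x.shift μ) = (liftSiteCtr F K 0 x).shift μ := by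
  have hstep : (x μ + 1).valMinAbs = (x μ).valMinAbs + 1 :=
    valMinAbs_add_one_of_ne_half (even_sitesPerDir F K) (x μ) (valMinAbs_ne_half_of_val_ne_half (x μ) hx)
  show (fun ν : Fin (F.P K).d => (((Function.update x μ (x μ + 1) ν).valMinAbs : ℤ) : ZMod ((F.P (K + 1)).sitesPerDir 0))) =
    @Function.update (Fin (F.P K).d) (fun _ => ZMod ((F.P (K + 1)).sitesPerDir 0)) _
      (fun ν => (((x ν).valMinAbs : ℤ) : ZMod ((F.P (K + 1)).sitesPerDir 0))) μ
      ((((x μ).valMinAbs : ℤ) : ZMod ((F.P (K + 1)).sitesPerDir 0)) + 1)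
  funext ν
  by_cases hν : ν = μ
  · subst hν
    rw [Function.update_self, Function.update_self, hstep]
    push_cast
    ring
  · rw [Function.update_of_ne hν, Function.update_of_ne hν]

variable {F} in
/-- Sites of an off-wrap domain lie off the antipodal site layer in every direction. [cite: Balaban1987RG1, (1.21) p.264 (bookkeeping)] -/
theorem val_ne_half_of_mem_domSites {Mc k K : ℕ} (hMc : McGuard F Mc) (hK : recordK₀ F Mc k ≤ K) {X : (recordDomSys F Mc k K).Dom}
    (hX : X ∉ recordWrapCtr F Mc k K) {x : Site (F.P K) 0} (hx : x ∈ Sect2.domSites (F.P K) Mc (k + 1) X) (μ : Fin (F.P K).d) :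
    (x μ).val ≠ (F.P K).sitesPerDir 0 / 2 := by
  intro hv
  rw [mem_domSites_iff hMc hK X x] at hx
  apply not_onSeamCtr_of_mem hX hx
  refine ⟨μ, ?_⟩
  show ((((x μ).val / side (F.P K).L Mc (k + 1) : ℕ) : ZMod (Sect2.domCount (F.P K) Mc (k + 1)))).valMinAbs = _
  rw [hv, sitesPerDir_div_two hMc hK, Nat.mul_div_cancel_left _ (side_pos F Mc k K hMc), ZMod.valMinAbs_natCast_of_le_half le_rfl]

variable {F} in
/-- The far endpoint of the centred lift of a bond whose source lies off the antipodal site layer is the centred lift of the far endpoint.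
[cite: Balaban1987RG1, (1.21) p.264 (bookkeeping)] -/
theorem liftBondCtr_tgt {K : ℕ} (b : PBond (F.P K) 0) (hb : (b.src b.dir).val ≠ (F.P K).sitesPerDir 0 / 2) :
    (liftBondCtr F K 0 b).tgt = liftSiteCtr F K 0 b.tgt := by
  show (liftSiteCtr F K 0 b.src).shift b.dir = liftSiteCtr F K 0 (b.src.shift b.dir)
  rw [liftSiteCtr_shift b.src b.dir hb]

variable {F} in
/-- **A FINE BOND LIES IN `X` IFF ITS CENTRED LIFT LIES IN `emb X`** (`X ∉ recordWrapCtr`, tiled range). [cite: Balaban1987RG1, (1.7) p.261, (1.21) p.264] -/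
theorem liftBondCtr_mem_domBonds_iff {Mc k K : ℕ} (hMc : McGuard F Mc) (hK : recordK₀ F Mc k ≤ K) (X : (recordDomSys F Mc k K).Dom)
    (hX : X ∉ recordWrapCtr F Mc k K) (b : PBond (F.P K) 0) :
    liftBondCtr F K 0 b ∈ domBonds F Mc k (K + 1) (recordDomEmbCtr F Mc k K X) ↔ b ∈ domBonds F Mc k K X := by
  have hsrc : (liftBondCtr F K 0 b).src = liftSiteCtr F K 0 b.src := rfl
  constructor
  · rintro ⟨hs', ht'⟩
    rw [hsrc, liftSiteCtr_mem_domSites_iff hMc hK X hX] at hs'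
    rw [liftBondCtr_tgt b (val_ne_half_of_mem_domSites hMc hK hX hs' b.dir), liftSiteCtr_mem_domSites_iff hMc hK X hX] at ht'
    exact ⟨hs', ht'⟩
  · rintro ⟨hs, ht⟩
    refine ⟨?_, ?_⟩
    · rw [hsrc, liftSiteCtr_mem_domSites_iff hMc hK X hX]; exact hs
    · rw [liftBondCtr_tgt b (val_ne_half_of_mem_domSites hMc hK hX hs b.dir), liftSiteCtr_mem_domSites_iff hMc hK X hX]; exact ht

/-! ## §7  ROW (R3) — INDEX COMPATIBILITY — and ROW (R5) — CHART INTERTWINING — of `B12FormatPlus.Response9D` AT THE NAMES -/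

variable {F} in
/-- The chart-input index `(b, t)` lies «in X» iff the bond `b` does. [cite: Balaban1987RG1, (1.7) p.261 (bookkeeping)] -/
theorem chartEquivJ_mem_recordCXJ_iff {Mc k K : ℕ} (X : (recordDomSys F Mc k K).Dom) (b : PBond (F.P K) 0) (t : Fin 3 ⊕ Fin 3) :
    chartEquivJ F K (b, t) ∈ recordCXJ F Mc k K X ↔ b ∈ domBonds F Mc k K X := by
  classical
  simp [recordCXJ]

/-- The centred index lift on a chart-input index. [cite: Balaban1987RG1, (1.21) p.264 (bookkeeping)] -/
theorem recordJXJ_chartEquivJ {K : ℕ} (b : PBond (F.P K) 0) (t : Fin 3 ⊕ Fin 3) :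
    recordJXJ F K (chartEquivJ F K (b, t)) = chartEquivJ F (K + 1) (liftBondCtr F K 0 b, t) := by
  simp [recordJXJ]

variable {F} in
/-- ★ **ROW (R3) AT THE NAMES**: off the wrap class the centred index lift carries the chart inputs of `X` into the chart inputs of `emb X`.
[cite: Balaban1987RG1, (1.7) p.261, (1.21) p.264] -/
theorem rowR3_record {Mc k K : ℕ} (hMc : McGuard F Mc) (hK : recordK₀ F Mc k ≤ K) (X : (recordDomSys F Mc k K).Dom)
    (hX : X ∉ recordWrapCtr F Mc k K) {i : Fin (recordChartDimJ F K)} (hi : i ∈ recordCXJ F Mc k K X) :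
    recordJXJ F K i ∈ recordCXJ F Mc k (K + 1) (recordDomEmbCtr F Mc k K X) := by
  classical
  obtain ⟨⟨b, t⟩, rfl⟩ := (chartEquivJ F K).surjective i
  rw [recordJXJ_chartEquivJ, chartEquivJ_mem_recordCXJ_iff, liftBondCtr_mem_domBonds_iff hMc hK X hX]
  exact (chartEquivJ_mem_recordCXJ_iff X b t).1 hi

variable {F} in
/-- The `𝐔`-block chart matrix of the RESTRICTED inputs on a bond of `X` is the `𝐔`-block chart matrix of the inputs on the lifted bond.
[cite: Balaban1987RG1, (1.7) p.261, (4.35) p.290 (bookkeeping)] -/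
theorem chartMatU_restrict {Mc k K : ℕ} (X : (recordDomSys F Mc k K).Dom) (w' : Fin (recordChartDimJ F (K + 1)) → ℂ)
    {b : PBond (F.P K) 0} (hb : b ∈ domBonds F Mc k K X) :
    chartMatU F K (B12FormatPlus.restrictCLM (recordCXJ F Mc k K X) (recordJXJ F K) w') b = chartMatU F (K + 1) w' (liftBondCtr F K 0 b) := by
  unfold chartMatU
  refine Finset.sum_congr rfl fun a _ => ?_
  rw [B12FormatPlus.restrictCLM_apply, if_pos ((chartEquivJ_mem_recordCXJ_iff X b _).2 hb), recordJXJ_chartEquivJ]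

variable {F} in
/-- The `𝐉`-block chart matrix of the restricted inputs on a bond of `X`. [cite: Balaban1987RG1, (1.9) p.261, (4.35) p.290 (bookkeeping)] -/
theorem chartMatJc_restrict {Mc k K : ℕ} (X : (recordDomSys F Mc k K).Dom) (w' : Fin (recordChartDimJ F (K + 1)) → ℂ)
    {b : PBond (F.P K) 0} (hb : b ∈ domBonds F Mc k K X) :
    chartMatJc F K (B12FormatPlus.restrictCLM (recordCXJ F Mc k K X) (recordJXJ F K) w') b = chartMatJc F (K + 1) w' (liftBondCtr F K 0 b) := by
  unfold chartMatJc
  refine Finset.sum_congr rfl fun a _ => ?_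
  rw [B12FormatPlus.restrictCLM_apply, if_pos ((chartEquivJ_mem_recordCXJ_iff X b _).2 hb), recordJXJ_chartEquivJ]

variable {F} in
/-- ★ **ROW (R5) AT THE NAMES — CHART INTERTWINING**: off the wrap class, projecting the larger volume's two-block chart of `emb X` back to the
(centred-lifted) coordinates of `T_K` equals the smaller volume's chart of `X` on the restricted inputs. [cite: Balaban1987RG1, (4.35) p.290, (1.21) p.264, (1.7) p.261] -/
theorem rowR5_record {Mc k K : ℕ} (hMc : McGuard F Mc) (hK : recordK₀ F Mc k ≤ K) (X : (recordDomSys F Mc k K).Dom)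
    (hX : X ∉ recordWrapCtr F Mc k K) (w' : Fin (recordChartDimJ F (K + 1)) → ℂ) :
    recordCoordProjCtr F K (recordChartJ F Mc k (K + 1) (recordDomEmbCtr F Mc k K X) w') =
      recordChartJ F Mc k K X (B12FormatPlus.restrictCLM (recordCXJ F Mc k K X) (recordJXJ F K) w') := by
  classical
  have hbond := liftBondCtr_mem_domBonds_iff hMc hK X hX
  funext n
  obtain ⟨⟨b | b, e⟩, rfl⟩ := (cfgEquiv F K).surjective n
  · -- a `𝐔`-coordinate
    simp only [recordCoordProjCtr, recordChartJ, encodeCfg, Equiv.symm_apply_apply, liftCfgIdxCtr, Prod.map_apply,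
      Sum.map_inl, Sum.elim_inl, id]
    by_cases hb : b ∈ domBonds F Mc k K X
    · rw [if_pos ((hbond b).2 hb), if_pos hb, chartMatU_restrict X w' hb]
    · rw [if_neg (mt (hbond b).1 hb), if_neg hb]
  · -- a `𝐉`-coordinate
    simp only [recordCoordProjCtr, recordChartJ, encodeCfg, Equiv.symm_apply_apply, liftCfgIdxCtr, Prod.map_apply,
      Sum.map_inr, Sum.elim_inr, id]
    by_cases hb : b ∈ domBonds F Mc k K X
    · rw [if_pos ((hbond b).2 hb), if_pos hb, chartMatJc_restrict X w' hb]
    · rw [if_neg (mt (hbond b).1 hb), if_neg hb]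


/-! ## §8  The rows in the shape `B12FormatPlus.Response9D` reads them (family member `n` = volume `recordK₀ F Mc k + n`), and the FRAME:
`Response9D` at the record's two-block data FROM its two decay rows (R1ᴰ), (R4ᴰ) — (R0), (R3), (R5) discharged here -/

variable {F} in
/-- ★ Row (R3) of `Response9D` for the record's two-block response data from the base volume `recordK₀ F Mc k` — PROVED (every member is on the tiled range).
[cite: Balaban1987RG1, (1.7) p.261, (1.21) p.264] -/
theorem rowR3_fromJ {Mc : ℕ} (hMc : McGuard F Mc) (θ : Stage13Params F 2) (a : θ.ιβ) (k n : ℕ)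
    (X : (recordDomSys F Mc k (recordK₀ F Mc k + n)).Dom) (hX : X ∉ (recordResponse9DataFromJ F θ a Mc k (recordK₀ F Mc k)).wrap n)
    {i : Fin (recordChartDimJ F (recordK₀ F Mc k + n))} (hi : i ∈ (recordResponse9DataFromJ F θ a Mc k (recordK₀ F Mc k)).cX n X) :
    (recordResponse9DataFromJ F θ a Mc k (recordK₀ F Mc k)).jX n X i ∈
      (recordResponse9DataFromJ F θ a Mc k (recordK₀ F Mc k)).cX (n + 1) ((recordResponse9DataFromJ F θ a Mc k (recordK₀ F Mc k)).emb n X) :=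
  rowR3_record hMc (Nat.le_add_right _ _) X hX hi

variable {F} in
/-- ★ Row (R5) of `Response9D` for the record's two-block response data and two-block chart from the base volume `recordK₀ F Mc k` — PROVED.
[cite: Balaban1987RG1, (4.35) p.290, (1.21) p.264] -/
theorem rowR5_fromJ {Mc : ℕ} (hMc : McGuard F Mc) (θ : Stage13Params F 2) (a : θ.ιβ) (k n : ℕ)
    (X : (recordDomSys F Mc k (recordK₀ F Mc k + n)).Dom) (hX : X ∉ (recordResponse9DataFromJ F θ a Mc k (recordK₀ F Mc k)).wrap n)
    (w' : Fin (recordChartDimJ F (recordK₀ F Mc k + (n + 1))) → ℂ) :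
    (recordResponse9DataFromJ F θ a Mc k (recordK₀ F Mc k)).πc n X (recordChartJ F Mc k (recordK₀ F Mc k + (n + 1))
        ((recordResponse9DataFromJ F θ a Mc k (recordK₀ F Mc k)).emb n X) w') =
      recordChartJ F Mc k (recordK₀ F Mc k + n) X
        (B12FormatPlus.restrictCLM ((recordResponse9DataFromJ F θ a Mc k (recordK₀ F Mc k)).cX n X)
          ((recordResponse9DataFromJ F θ a Mc k (recordK₀ F Mc k)).jX n X) w') :=
  rowR5_record hMc (Nat.le_add_right _ _) X hX w'

variable {F} in
/-- ★★ **THE FRAME — `Response9D` AT THE RECORD FROM ITS TWO DECAY ROWS**: for the record's two-block response data from the base volume `recordK₀ F Mc k`, the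
two-block chart, the window RADIUS `recordRNat` and print's (4.4) domain `recordDom44J … α₂`, the obligation `B12FormatPlus.Response9D … C₉ δ₀` HOLDS as soon as
`0 ≤ C₉`, `0 ≤ δ₀` and its two DECAY rows hold — (R1ᴰ) the gauge decay of the cut responses ([15] Prop. 9 (190) ∕ [I] p.282, CONTENT, displayed) and (R4ᴰ) the
two-volume comparison on the centred window (CONTENT, displayed); the bookkeeping rows (R3) ∕ (R5) are the theorems above.  Nothing of [15] is asserted.
[cite: Balaban1985Variational, Prop. 9 p.309; Balaban1987RG1, (1.7) p.261, (1.21) p.264, (4.4) p.281, (4.35) p.290] -/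
theorem response9D_fromJ_of_decayRows {Mc : ℕ} (hMc : McGuard F Mc) (θ : Stage13Params F 2) (a : θ.ιβ) (k : ℕ) {α₂ C₉ δ₀ : ℝ}
    (hC : 0 ≤ C₉) (hδ : 0 ≤ δ₀)
    (hR1 : ∀ (n : ℕ) (X : (recordDomSys F Mc k (recordK₀ F Mc k + n)).Dom) (y : RespLabel F k (recordK₀ F Mc k + n)),
      gauge (recordDom44J F Mc k (recordK₀ F Mc k + n) X α₂)
        (B12FormatPlus.cutTo (recordCXJ F Mc k (recordK₀ F Mc k + n) X) (recordGkJ F θ k (recordK₀ F Mc k + n) a y)) ≤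
        C₉ * Real.exp (-δ₀ * (recordSiteGeom F Mc k (recordK₀ F Mc k + n)).distD y X))
    (hR4 : ∀ (n : ℕ) (X : (recordDomSys F Mc k (recordK₀ F Mc k + n)).Dom), X ∉ recordWrapCtr F Mc k (recordK₀ F Mc k + n) →
      ∀ (μ : Fin 4) (z : Fin 4 → ℤ), (∀ l, 2 * |z l| < (recordRNat F Mc k (recordK₀ F Mc k + n) : ℤ)) →
      gauge (recordDom44J F Mc k (recordK₀ F Mc k + n) X α₂)
        (B12FormatPlus.cutTo (recordCXJ F Mc k (recordK₀ F Mc k + n) X) fun i =>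
          recordGkJ F θ k (recordK₀ F Mc k + (n + 1)) a (recordE F k (recordK₀ F Mc k + (n + 1)) μ z) (recordJXJ F (recordK₀ F Mc k + n) i) -
            recordGkJ F θ k (recordK₀ F Mc k + n) a (recordE F k (recordK₀ F Mc k + n) μ z) i) ≤
        C₉ * Real.exp (-δ₀ * (recordRNat F Mc k (recordK₀ F Mc k + n) : ℝ) / 2) *
          Real.exp (-(δ₀ / 2) * (recordSiteGeom F Mc k (recordK₀ F Mc k + n)).distD (recordE F k (recordK₀ F Mc k + n) μ z) X)) :
    B12FormatPlus.Response9D (recordResponse9DataFromJ F θ a Mc k (recordK₀ F Mc k)) (fun n => recordChartJ F Mc k (recordK₀ F Mc k + n))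
      (fun n => recordRNat F Mc k (recordK₀ F Mc k + n)) (fun n X => recordDom44J F Mc k (recordK₀ F Mc k + n) X α₂) C₉ δ₀ :=
  ⟨hC, hδ, hR1, fun n X hX _ hi => rowR3_fromJ hMc θ a k n X hX hi, hR4, fun n X hX w' => rowR5_fromJ hMc θ a k n X hX w'⟩

end Summit.QuantumFields.YangMills.Theorems.PortU8

end
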